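import Literature.NumberTheory.Sieve.RoughNumbersBuchstabMainSum
import Literature.NumberTheory.Sieve.RoughNumbersBuchstabIdentity
import Literature.NumberTheory.LFunctions.PrimeSumStandardWeights
import HarnessLib

/-!
# Rough numbers and Buchstab's function: the inductive step `k → k + 1`

Topic `Literature/NumberTheory/Sieve`. Everything here is PROVED. Write
`Φ(x, y) = #roughIcc ⌈y⌉₊ ⌊x⌋₊ = #{1 ≤ n ≤ x : p ∣ n ⇒ p ≥ y}`, `u = log x/log y` and
`M(x, y) = (x ω(u) − y)/log y`. The statement `P(k, C)`:
"`|Φ(x, y) − M(x, y)| ≤ C x/log² y` for all `2 ≤ y ≤ x` with `log x ≤ k log y`"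
passes from `k` to `k + 1` (`k ≥ 2`) with an explicit new constant (`abs_card_roughIcc_sub_main_step`):
for `k log y < log x ≤ (k + 1) log y` and `y ≥ e²` put `z = x^{1/k}`; Buchstab's identity
`Φ(x, y) = Φ(x, z) + ∑_{y ≤ p < z} Φ(x/p, p)` (`card_roughIcc_eq_card_add_sum`), the hypothesis
`P(k, C)` for `Φ(x, z)` and for every `Φ(x/p, p)` (`abs_sum_card_sub_sum_main_le`), the main sum
`∑ x ω(u_p)/(p log p) = (x/log x)(u ω(u) − k ω(k)) + O(x/log² y)`
(`abs_sum_buchstabWeight_sub_main_le`) and `∑ p/log p`, `∑ 1/p` (`PrimeSumStandardWeights`)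
give `P(k + 1, C')`. This is the induction of Harman, *Prime-Detecting Sieves*, Appendix A.2 /
Tenenbaum Ch. III.6, for Lichtman's Lemma 6.1; the assembly is `RoughNumbersBuchstab.lean`.

## References

* J. D. Lichtman, arXiv:2109.02851, §6.1, Lemma 6.1. [Lichtman2025LinearSieve]
* G. Harman, *Prime-Detecting Sieves* (2007), Appendix A.2 (A.2.1)–(A.2.3).
-/

open Finset Real MeasureTheory Set
open scoped Chebyshev

noncomputable section

namespace Literature.NumberTheory.Sieve

/-- **The hypothesis `P(k, C)` summed over the primes of the Buchstab range.** If
`|Φ(X, Y) − M(X, Y)| ≤ C X/log² Y` whenever `2 ≤ Y ≤ X`, `log X ≤ k log Y`, then for primes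
`p ∈ (⌊a⌋, ⌊b⌋]` (`e ≤ a ≤ b`, `log b ≤ 3 log a`) with `y ≤ p`, `p² ≤ x`, `log x ≤ (k + 1) log p`:
`|∑_p Φ(x/p, p) − ∑_p ((x/p) ω(log x/log p − 1) − p)/log p| ≤ C (3 + 8C₀) x/log² y`
(each term is `≤ C x/(p log² p)`, and `∑ 1/p ≤ 3(1 + 2C₀) + 2C₀`). [folklore] -/
theorem abs_sum_card_sub_sum_main_le {k : ℕ} {C C₀ x y a b : ℝ} (hC : 0 ≤ C) (hC₀ : 0 ≤ C₀)
    (hE : ∀ t : ℝ, 2 ≤ t → |θ t - t| ≤ C₀ * t / Real.log t ^ 2)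
    (ha : Real.exp 1 ≤ a) (hab : a ≤ b) (hba : Real.log b ≤ 3 * Real.log a) (hy : 1 < y)
    (hx : 0 ≤ x)
    (hP : ∀ X Y : ℝ, 2 ≤ Y → Y ≤ X → Real.log X ≤ k * Real.log Y →
      |((roughIcc ⌈Y⌉₊ ⌊X⌋₊).card : ℝ) -
        (X * buchstabOmega (Real.log X / Real.log Y) - Y) / Real.log Y| ≤ C * X / Real.log Y ^ 2)
    (hpy : ∀ p ∈ (Finset.Ioc ⌊a⌋₊ ⌊b⌋₊).filter Nat.Prime, y ≤ (p : ℝ))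
    (hpx : ∀ p ∈ (Finset.Ioc ⌊a⌋₊ ⌊b⌋₊).filter Nat.Prime, (p : ℝ) ^ 2 ≤ x)
    (hxp : ∀ p ∈ (Finset.Ioc ⌊a⌋₊ ⌊b⌋₊).filter Nat.Prime, Real.log x ≤ (k + 1) * Real.log p) :
    |∑ p ∈ (Finset.Ioc ⌊a⌋₊ ⌊b⌋₊).filter Nat.Prime, ((roughIcc p (⌊x⌋₊ / p)).card : ℝ) -
      ∑ p ∈ (Finset.Ioc ⌊a⌋₊ ⌊b⌋₊).filter Nat.Prime,
        (x / p * buchstabOmega (Real.log x / Real.log p - 1) - p) / Real.log p| ≤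
      C * (3 + 8 * C₀) * x / Real.log y ^ 2 := by
  set S := (Finset.Ioc ⌊a⌋₊ ⌊b⌋₊).filter Nat.Prime with hS
  have hly : 0 < Real.log y := Real.log_pos hy
  -- termwise: the hypothesis at `(x/p, p)`
  have hterm : ∀ p ∈ S, |((roughIcc p (⌊x⌋₊ / p)).card : ℝ) -
      (x / p * buchstabOmega (Real.log x / Real.log p - 1) - p) / Real.log p| ≤
      C * x / Real.log y ^ 2 * (p : ℝ)⁻¹ := by
    intro p hp
    have hpP := (Finset.mem_filter.mp hp).2
    have hp2 : (2 : ℝ) ≤ p := by exact_mod_cast hpP.two_le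
    have hp0 : (0 : ℝ) < p := by linarith
    have hpp : (p : ℝ) ≤ x / p := by
      rw [le_div_iff₀ hp0, ← sq]; exact hpx p hp
    have hx0' : 0 < x := lt_of_lt_of_le (by positivity) (hpx p hp)
    have hlogp : 0 < Real.log p := Real.log_pos (by linarith)
    have hlog : Real.log (x / p) = Real.log x - Real.log p := Real.log_div hx0'.ne' hp0.ne'
    have hcond : Real.log (x / p) ≤ k * Real.log p := by
      rw [hlog]; have := hxp p hp; linarith
    have h := hP (x / p) p hp2 hpp hcond
    have key : (Real.log x - Real.log p) / Real.log p = Real.log x / Real.log p - 1 := by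
      rw [sub_div, div_self hlogp.ne']
    rw [Nat.ceil_natCast, Nat.floor_div_natCast, hlog, key] at h
    refine h.trans ?_
    have hlyp : Real.log y ≤ Real.log p := Real.log_le_log (by linarith) (hpy p hp)
    calc C * (x / p) / Real.log p ^ 2 = C * x / Real.log p ^ 2 * (p : ℝ)⁻¹ := by
          field_simp
      _ ≤ C * x / Real.log y ^ 2 * (p : ℝ)⁻¹ := by gcongr
  have hsum := Literature.NumberTheory.LFunctions.sum_primes_Ioc_inv_le ha hab hC₀ hE
  have ha0 : 0 < a := (Real.exp_pos 1).trans_le ha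
  have hla : 1 ≤ Real.log a := by rw [Real.le_log_iff_exp_le ha0]; exact ha
  have hratio : Real.log b / Real.log a ≤ 3 := by rw [div_le_iff₀ (by linarith)]; exact hba
  have hx0 : 0 ≤ C * x / Real.log y ^ 2 := by positivity
  rw [← Finset.sum_sub_distrib]
  refine (Finset.abs_sum_le_sum_abs _ _).trans ?_
  calc ∑ p ∈ S, |((roughIcc p (⌊x⌋₊ / p)).card : ℝ) -
        (x / p * buchstabOmega (Real.log x / Real.log p - 1) - p) / Real.log p|
      ≤ ∑ p ∈ S, C * x / Real.log y ^ 2 * (p : ℝ)⁻¹ := Finset.sum_le_sum hterm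
    _ = C * x / Real.log y ^ 2 * ∑ p ∈ S, (p : ℝ)⁻¹ := by rw [Finset.mul_sum]
    _ ≤ C * x / Real.log y ^ 2 * ((1 + 2 * C₀) * (Real.log b / Real.log a) + 2 * C₀) := by
        gcongr
    _ ≤ C * x / Real.log y ^ 2 * ((1 + 2 * C₀) * 3 + 2 * C₀) := by gcongr
    _ = C * (3 + 8 * C₀) * x / Real.log y ^ 2 := by ring

/-- **Assembly of the inductive step** (all elementary inequalities between the parameters
`y < z = x^{1/k}`, `a = ⌈y⌉ − 1`, `b = ⌈z⌉ − 1` supplied as hypotheses; see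
`abs_card_roughIcc_sub_main_step` for the self-contained statement): Buchstab's identity, the
hypothesis `P(k, C)` at `(x, z)` and at the `(x/p, p)`, the main sum and `∑ p/log p`. [folklore] -/
theorem abs_card_roughIcc_sub_main_step_of {k : ℕ} (hk : 2 ≤ k) {C C₀ : ℝ} (hC : 0 ≤ C)
    (hC₀ : 0 ≤ C₀) (hE : ∀ t : ℝ, 2 ≤ t → |θ t - t| ≤ C₀ * t / Real.log t ^ 2)
    (hP : ∀ X Y : ℝ, 2 ≤ Y → Y ≤ X → Real.log X ≤ k * Real.log Y →
      |((roughIcc ⌈Y⌉₊ ⌊X⌋₊).card : ℝ) -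
        (X * buchstabOmega (Real.log X / Real.log Y) - Y) / Real.log Y| ≤ C * X / Real.log Y ^ 2)
    {x y z a b : ℝ} {N M : ℕ} (hNdef : ⌈y⌉₊ = N) (hMdef : ⌈z⌉₊ = M) (hNM : N ≤ M)
    (hS : (Finset.Ico N M).filter Nat.Prime = (Finset.Ioc ⌊a⌋₊ ⌊b⌋₊).filter Nat.Prime)
    (hx0 : 0 < x) (hx1 : 1 ≤ x) (hy0 : 0 < y) (hy1 : 1 < y) (hly : 0 < Real.log y)
    (hz0 : 0 < z) (hz2 : 2 ≤ z) (hzx : z ≤ x) (hzz : z * z ≤ x) (hyz : y ≤ z)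
    (hlz : Real.log y < Real.log z) (hz_log : Real.log z = Real.log x / k)
    (hyu : (k : ℝ) ≤ Real.log x / Real.log y) (hxy : Real.log x ≤ (k + 1) * Real.log y)
    (hea : Real.exp 1 ≤ a) (hay : a ≤ y) (hya : y ≤ a + 1) (hab : a ≤ b) (hbz : b < z)
    (hzb : z ≤ b + 1) (hb0 : 0 < b) (hlb : Real.log b ≤ 3 * Real.log a)
    (hlya : Real.log y ≤ 2 * Real.log a) (hxa : Real.log x ≤ 2 * (k + 1) * Real.log a)
    (hpy : ∀ p ∈ (Finset.Ioc ⌊a⌋₊ ⌊b⌋₊).filter Nat.Prime, y ≤ (p : ℝ))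
    (hpx : ∀ p ∈ (Finset.Ioc ⌊a⌋₊ ⌊b⌋₊).filter Nat.Prime, (p : ℝ) ^ 2 ≤ x)
    (hxp : ∀ p ∈ (Finset.Ioc ⌊a⌋₊ ⌊b⌋₊).filter Nat.Prime, Real.log x ≤ (k + 1) * Real.log p) :
    |((roughIcc ⌈y⌉₊ ⌊x⌋₊).card : ℝ) -
        (x * buchstabOmega (Real.log x / Real.log y) - y) / Real.log y| ≤
      (C * (4 + 8 * C₀) + (12 * k + 172) * C₀ + 16) * x / Real.log y ^ 2 := by
  have hk2 : (2 : ℝ) ≤ k := by exact_mod_cast hk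
  have hk0 : (0 : ℝ) < k := by linarith
  have ha0 : 0 < a := (Real.exp_pos 1).trans_le hea
  have hla : 1 ≤ Real.log a := by rw [Real.le_log_iff_exp_le ha0]; exact hea
  have hLx : 0 < Real.log x := by
    have : 0 < Real.log x / Real.log y := hk0.trans_le hyu
    exact (div_pos_iff_of_pos_right hly).mp this
  set S := (Finset.Ioc ⌊a⌋₊ ⌊b⌋₊).filter Nat.Prime with hS_def
  set X := ⌊x⌋₊ with hX
  -- Buchstab's identity
  have hBuch := card_roughIcc_eq_card_add_sum hNM X
  rw [hS] at hBuch
  have hΦ : ((roughIcc N X).card : ℝ) =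
      ((roughIcc M X).card : ℝ) + ∑ p ∈ S, ((roughIcc p (X / p)).card : ℝ) := by
    rw [hBuch]; push_cast; rfl
  -- the four estimates
  have hxz : Real.log x / Real.log z = k := by rw [hz_log]; field_simp
  have hR1 := hP x z hz2 hzx (le_of_eq (by rw [hz_log]; field_simp))
  rw [hxz, hMdef] at hR1
  have hR2 := abs_sum_card_sub_sum_main_le hC hC₀ hE hea hab hlb hy1 hx0.le hP hpy hpx hxp
  have hR3 := abs_sum_buchstabWeight_sub_main_le hk hC₀ hE hea hay hya hab hbz hzb hyz hz_log
    hyu hxy hxa hlb hx1 hpy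
  have hR4 := Literature.NumberTheory.LFunctions.sum_primes_Ioc_div_log_le hea hab hC₀ hE
  have hV0 : 0 ≤ ∑ p ∈ S, (p : ℝ) / Real.log p := Finset.sum_nonneg fun p hp => by
    have h2 := (Finset.mem_filter.mp hp).2.two_le
    have : (2 : ℝ) ≤ p := by exact_mod_cast h2
    have : 0 < Real.log p := Real.log_pos (by linarith)
    positivity
  have hsplit : ∑ p ∈ S, (x / p * buchstabOmega (Real.log x / Real.log p - 1) - p) / Real.log p =
      ∑ p ∈ S, x * buchstabOmega (Real.log x / Real.log p - 1) / (p * Real.log p) -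
        ∑ p ∈ S, (p : ℝ) / Real.log p := by
    rw [← Finset.sum_sub_distrib]
    refine Finset.sum_congr rfl fun p _ => ?_
    rw [sub_div, div_mul_eq_mul_div, div_div]
  -- the algebraic identity behind the main terms
  set u := Real.log x / Real.log y with hu_def
  have hident : (x * buchstabOmega k - z) / Real.log z +
      x / Real.log x * (u * buchstabOmega u - k * buchstabOmega k) -
      (x * buchstabOmega u - y) / Real.log y = y / Real.log y - z / Real.log z := by
    rw [hz_log, hu_def]
    field_simp
    ring
  have hmain_eq : ((roughIcc N X).card : ℝ) - (x * buchstabOmega u - y) / Real.log y =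
      (((roughIcc M X).card : ℝ) - (x * buchstabOmega k - z) / Real.log z) +
      (∑ p ∈ S, ((roughIcc p (X / p)).card : ℝ) -
        ∑ p ∈ S, (x / p * buchstabOmega (Real.log x / Real.log p - 1) - p) / Real.log p) +
      (∑ p ∈ S, x * buchstabOmega (Real.log x / Real.log p - 1) / (p * Real.log p) -
        x / Real.log x * (u * buchstabOmega u - k * buchstabOmega k)) -
      ∑ p ∈ S, (p : ℝ) / Real.log p + (y / Real.log y - z / Real.log z) := by
    rw [hΦ, hsplit, ← hident]
    ring
  -- conversion of all bounds to multiples of `U = x/log² y`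
  set U := x / Real.log y ^ 2 with hU
  have hU0 : 0 ≤ U := by positivity
  have hlz0 : 0 < Real.log z := by linarith
  have hratio : 1 / Real.log a ^ 2 ≤ 4 / Real.log y ^ 2 := by
    rw [div_le_div_iff₀ (by positivity) (by positivity)]
    have h := mul_le_mul hlya hlya hly.le (by linarith)
    linarith
  have hxa4 : x / Real.log a ^ 2 ≤ 4 * U := by
    calc x / Real.log a ^ 2 = x * (1 / Real.log a ^ 2) := by ring
      _ ≤ x * (4 / Real.log y ^ 2) := by gcongr
      _ = 4 * U := by rw [hU]; ring
  have hb1 : C * x / Real.log z ^ 2 ≤ C * U := by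
    rw [hU, ← mul_div_assoc]
    gcongr
  have hb2 : C * (3 + 8 * C₀) * x / Real.log y ^ 2 = C * (3 + 8 * C₀) * U := by
    rw [hU]; ring
  have hb3 : ((3 * k + 38) * C₀ + 2) * x / Real.log a ^ 2 ≤ 4 * ((3 * k + 38) * C₀ + 2) * U := by
    have hk0' : (0 : ℝ) ≤ k := hk0.le
    calc ((3 * k + 38) * C₀ + 2) * x / Real.log a ^ 2
        = ((3 * k + 38) * C₀ + 2) * (x / Real.log a ^ 2) := by ring
      _ ≤ ((3 * k + 38) * C₀ + 2) * (4 * U) := by gcongr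
      _ = _ := by ring
  have hb4 : (1 + 5 * C₀) * b ^ 2 / Real.log a ^ 2 ≤ 4 * (1 + 5 * C₀) * U := by
    have hbz' : b ^ 2 ≤ z * z := by
      rw [sq]; exact mul_le_mul hbz.le hbz.le hb0.le hz0.le
    have hb2x : b ^ 2 ≤ x := hbz'.trans hzz
    calc (1 + 5 * C₀) * b ^ 2 / Real.log a ^ 2 = (1 + 5 * C₀) * (b ^ 2 * (1 / Real.log a ^ 2)) := by
          ring
      _ ≤ (1 + 5 * C₀) * (x * (4 / Real.log y ^ 2)) := by gcongr
      _ = 4 * (1 + 5 * C₀) * U := by rw [hU]; ring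
  have hb5 : |y / Real.log y - z / Real.log z| ≤ 2 * U := by
    have hlogy : Real.log y ≤ y := by linarith [Real.log_le_sub_one_of_pos hy0]
    have hlogz : Real.log z ≤ z := by linarith [Real.log_le_sub_one_of_pos hz0]
    have hy2x : y * y ≤ x := le_trans (mul_le_mul hyz hyz hy0.le hz0.le) hzz
    have h1 : y / Real.log y ≤ U := by
      rw [hU, div_le_div_iff₀ hly (by positivity)]
      calc y * Real.log y ^ 2 = (y * Real.log y) * Real.log y := by ring
        _ ≤ (y * y) * Real.log y := by gcongr
        _ ≤ x * Real.log y := by gcongr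
    have h2 : z / Real.log z ≤ U := by
      calc z / Real.log z ≤ x / Real.log z ^ 2 := by
            rw [div_le_div_iff₀ hlz0 (by positivity)]
            calc z * Real.log z ^ 2 = (z * Real.log z) * Real.log z := by ring
              _ ≤ (z * z) * Real.log z := by gcongr
              _ ≤ x * Real.log z := by gcongr
        _ ≤ U := by rw [hU]; gcongr
    have h1' : 0 ≤ y / Real.log y := by positivity
    have h2' : 0 ≤ z / Real.log z := by positivity
    rw [abs_le]
    constructor <;> linarith
  -- assembly
  rw [hNdef, hmain_eq]
  set A := ((roughIcc M X).card : ℝ) - (x * buchstabOmega k - z) / Real.log z with hA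
  set B := ∑ p ∈ S, ((roughIcc p (X / p)).card : ℝ) -
    ∑ p ∈ S, (x / p * buchstabOmega (Real.log x / Real.log p - 1) - p) / Real.log p with hB
  set D := ∑ p ∈ S, x * buchstabOmega (Real.log x / Real.log p - 1) / (p * Real.log p) -
    x / Real.log x * (u * buchstabOmega u - k * buchstabOmega k) with hD
  set V := ∑ p ∈ S, (p : ℝ) / Real.log p with hV
  set E := y / Real.log y - z / Real.log z with hE_def
  have htri : |A + B + D - V + E| ≤ |A| + |B| + |D| + V + |E| := by
    have h1 := abs_add_le (A + B + D - V) E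
    have h2 := abs_sub (A + B + D) V
    have h3 := abs_add_le (A + B) D
    have h4 := abs_add_le A B
    rw [abs_of_nonneg hV0] at h2
    linarith
  have hk0' : (0 : ℝ) ≤ k := hk0.le
  have eA : |A| ≤ C * U := hR1.trans hb1
  have eB : |B| ≤ C * (3 + 8 * C₀) * U := hb2 ▸ hR2
  have eD : |D| ≤ 4 * ((3 * k + 38) * C₀ + 2) * U := hR3.trans hb3
  have eV : V ≤ 4 * (1 + 5 * C₀) * U := hR4.trans hb4
  calc |A + B + D - V + E| ≤ |A| + |B| + |D| + V + |E| := htri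
    _ ≤ C * U + C * (3 + 8 * C₀) * U + 4 * ((3 * k + 38) * C₀ + 2) * U +
        4 * (1 + 5 * C₀) * U + 2 * U := by linarith
    _ = (C * (4 + 8 * C₀) + (12 * k + 172) * C₀ + 14) * U := by ring
    _ ≤ (C * (4 + 8 * C₀) + (12 * k + 172) * C₀ + 16) * U := by gcongr; norm_num
    _ = (C * (4 + 8 * C₀) + (12 * k + 172) * C₀ + 16) * x / Real.log y ^ 2 := by
        rw [hU]; ring

/-- **The inductive step of Lichtman's Lemma 6.1 (main case).** Assume `P(k, C)` (`k ≥ 2`):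
`|Φ(X, Y) − M(X, Y)| ≤ C X/log² Y` for `2 ≤ Y ≤ X`, `log X ≤ k log Y`. Then for `e² ≤ y ≤ x` with
`k log y < log x ≤ (k + 1) log y`,
`|Φ(x, y) − M(x, y)| ≤ (C(4 + 8C₀) + (12k + 172) C₀ + 16) x/log² y`
(Buchstab's identity at `z = x^{1/k}`; Harman, Appendix A.2, proof of (A.2.3)).
[cite: Lichtman2025LinearSieve, Lemma 6.1] -/
theorem abs_card_roughIcc_sub_main_step {k : ℕ} (hk : 2 ≤ k) {C C₀ : ℝ} (hC : 0 ≤ C)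
    (hC₀ : 0 ≤ C₀) (hE : ∀ t : ℝ, 2 ≤ t → |θ t - t| ≤ C₀ * t / Real.log t ^ 2)
    (hP : ∀ X Y : ℝ, 2 ≤ Y → Y ≤ X → Real.log X ≤ k * Real.log Y →
      |((roughIcc ⌈Y⌉₊ ⌊X⌋₊).card : ℝ) -
        (X * buchstabOmega (Real.log X / Real.log Y) - Y) / Real.log Y| ≤ C * X / Real.log Y ^ 2)
    {x y : ℝ} (hy : Real.exp 2 ≤ y) (hyx : y ≤ x) (hkxy : k * Real.log y < Real.log x)
    (hxy : Real.log x ≤ (k + 1) * Real.log y) :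
    |((roughIcc ⌈y⌉₊ ⌊x⌋₊).card : ℝ) -
        (x * buchstabOmega (Real.log x / Real.log y) - y) / Real.log y| ≤
      (C * (4 + 8 * C₀) + (12 * k + 172) * C₀ + 16) * x / Real.log y ^ 2 := by
  -- numerics about `y`, `x`
  have hk2 : (2 : ℝ) ≤ k := by exact_mod_cast hk
  have hk0 : (0 : ℝ) < k := by linarith
  have he1 : (2 : ℝ) ≤ Real.exp 1 := by have := Real.add_one_le_exp (1 : ℝ); linarith
  have he2 : Real.exp 1 ≤ Real.exp 2 - 1 := by
    have h2 : Real.exp 2 = Real.exp 1 * Real.exp 1 := by rw [← Real.exp_add]; norm_num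
    nlinarith
  have hy0 : 0 < y := (Real.exp_pos 2).trans_le hy
  have hy3 : 3 ≤ y := le_trans (by have := Real.add_one_le_exp (2 : ℝ); linarith) hy
  have hy1 : 1 < y := by linarith
  have hly2 : 2 ≤ Real.log y := by rw [Real.le_log_iff_exp_le hy0]; exact hy
  have hly : 0 < Real.log y := by linarith
  have hLx : 0 < Real.log x := by
    have : (k : ℝ) * Real.log y ≥ 2 * 2 := mul_le_mul hk2 hly2 (by norm_num) hk0.le
    linarith
  have hx1 : 1 < x := by linarith
  have hx0 : 0 < x := by linarith
  have hyu : (k : ℝ) ≤ Real.log x / Real.log y := by rw [le_div_iff₀ hly]; exact hkxy.le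
  -- `z = x^{1/k}`
  set z : ℝ := Real.exp (Real.log x / k) with hz_def
  have hz0 : 0 < z := Real.exp_pos _
  have hz_log : Real.log z = Real.log x / k := Real.log_exp _
  have hyz : y < z := by
    have h : Real.log y < Real.log x / k := by rw [lt_div_iff₀ hk0]; linarith
    calc y = Real.exp (Real.log y) := (Real.exp_log hy0).symm
      _ < z := Real.exp_lt_exp.mpr h
  have hzz : z * z ≤ x := by
    have h : Real.log x / k + Real.log x / k ≤ Real.log x := by
      rw [← two_mul, ← mul_div_assoc, div_le_iff₀ hk0]
      have : Real.log x * 2 ≤ Real.log x * k := mul_le_mul_of_nonneg_left hk2 hLx.le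
      linarith
    calc z * z = Real.exp (Real.log x / k + Real.log x / k) := by rw [Real.exp_add]
      _ ≤ Real.exp (Real.log x) := Real.exp_le_exp.mpr h
      _ = x := Real.exp_log hx0
  have hz1 : 1 ≤ z := by linarith
  have hzx : z ≤ x := le_trans (le_mul_of_one_le_left hz0.le hz1) hzz
  have hz2 : (2 : ℝ) ≤ z := by linarith
  have hlz : Real.log y < Real.log z := Real.log_lt_log hy0 hyz
  -- `N = ⌈y⌉`, `M = ⌈z⌉`, `a = N − 1`, `b = M − 1`
  set N := ⌈y⌉₊ with hN
  set M := ⌈z⌉₊ with hM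
  have hN1 : 0 < N := Nat.ceil_pos.mpr hy0
  have hM1 : 0 < M := Nat.ceil_pos.mpr hz0
  have hNM : N ≤ M := Nat.ceil_le_ceil hyz.le
  set a : ℝ := ((N - 1 : ℕ) : ℝ) with ha_def
  set b : ℝ := ((M - 1 : ℕ) : ℝ) with hb_def
  have haN : a = (N : ℝ) - 1 := by rw [ha_def, Nat.cast_sub hN1, Nat.cast_one]
  have hbM : b = (M : ℝ) - 1 := by rw [hb_def, Nat.cast_sub hM1, Nat.cast_one]
  have hyN : y ≤ N := Nat.le_ceil y
  have hNy : (N : ℝ) < y + 1 := Nat.ceil_lt_add_one hy0.le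
  have hzM : z ≤ M := Nat.le_ceil z
  have hMz : (M : ℝ) < z + 1 := Nat.ceil_lt_add_one hz0.le
  have hay : a ≤ y := by rw [haN]; linarith
  have hya : y ≤ a + 1 := by rw [haN]; linarith
  have hbz : b < z := by rw [hbM]; linarith
  have hzb : z ≤ b + 1 := by rw [hbM]; linarith
  have hab : a ≤ b := by
    rw [haN, hbM]
    have : (N : ℝ) ≤ M := by exact_mod_cast hNM
    linarith
  have hea : Real.exp 1 ≤ a := by linarith
  have ha0 : 0 < a := (Real.exp_pos 1).trans_le hea
  have hla : 1 ≤ Real.log a := by rw [Real.le_log_iff_exp_le ha0]; exact hea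
  have hasq : y ≤ a ^ 2 := by
    have h1 : y - 1 ≤ a := by linarith
    have h2 : (y - 1) ^ 2 ≤ a ^ 2 := pow_le_pow_left₀ (by linarith) h1 2
    have h3 : y ≤ (y - 1) ^ 2 := by nlinarith
    exact h3.trans h2
  have hlya : Real.log y ≤ 2 * Real.log a := by
    calc Real.log y ≤ Real.log (a ^ 2) := Real.log_le_log hy0 hasq
      _ = 2 * Real.log a := by rw [Real.log_pow]; norm_num
  have hxa : Real.log x ≤ 2 * (k + 1) * Real.log a := by
    calc Real.log x ≤ (k + 1) * Real.log y := hxy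
      _ ≤ (k + 1) * (2 * Real.log a) := by gcongr
      _ = 2 * (k + 1) * Real.log a := by ring
  have hb0 : 0 < b := ha0.trans_le hab
  have hlb : Real.log b ≤ 3 * Real.log a := by
    have h1 : (k : ℝ) * Real.log b < Real.log x := by
      calc (k : ℝ) * Real.log b < k * Real.log z := by gcongr
        _ = Real.log x := by rw [hz_log]; field_simp
    have hkl : 2 * Real.log a ≤ (k : ℝ) * Real.log a := mul_le_mul_of_nonneg_right hk2 (by linarith)
    have h2 : Real.log x ≤ (k : ℝ) * (3 * Real.log a) := by
      calc Real.log x ≤ 2 * (k + 1) * Real.log a := hxa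
        _ ≤ (k : ℝ) * (3 * Real.log a) := by linarith
    exact (lt_of_mul_lt_mul_left (h1.trans_le h2) hk0.le).le
  -- the index set of primes `y ≤ p < z`
  have hfloor_a : ⌊a⌋₊ = N - 1 := by rw [ha_def, Nat.floor_natCast]
  have hfloor_b : ⌊b⌋₊ = M - 1 := by rw [hb_def, Nat.floor_natCast]
  have hS : (Finset.Ico N M).filter Nat.Prime = (Finset.Ioc ⌊a⌋₊ ⌊b⌋₊).filter Nat.Prime := by
    rw [hfloor_a, hfloor_b]
    congr 1
    ext p
    simp only [Finset.mem_Ico, Finset.mem_Ioc]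
    omega
  have hpS : ∀ p ∈ (Finset.Ioc ⌊a⌋₊ ⌊b⌋₊).filter Nat.Prime, y ≤ (p : ℝ) ∧ (p : ℝ) ≤ b := by
    intro p hp
    rw [Finset.mem_filter, Finset.mem_Ioc, hfloor_a, hfloor_b] at hp
    obtain ⟨⟨h1, h2⟩, -⟩ := hp
    refine ⟨?_, ?_⟩
    · have : N ≤ p := by omega
      calc y ≤ N := hyN
        _ ≤ p := by exact_mod_cast this
    · rw [hbM]
      have : p + 1 ≤ M := by omega
      have : (p : ℝ) + 1 ≤ M := by exact_mod_cast this
      linarith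
  have hpy : ∀ p ∈ (Finset.Ioc ⌊a⌋₊ ⌊b⌋₊).filter Nat.Prime, y ≤ (p : ℝ) := fun p hp => (hpS p hp).1
  have hpx : ∀ p ∈ (Finset.Ioc ⌊a⌋₊ ⌊b⌋₊).filter Nat.Prime, (p : ℝ) ^ 2 ≤ x := fun p hp => by
    obtain ⟨-, h2⟩ := hpS p hp
    have hpz : (p : ℝ) ≤ z := h2.trans hbz.le
    have hp0 : (0 : ℝ) ≤ p := Nat.cast_nonneg p
    rw [sq]
    exact le_trans (mul_le_mul hpz hpz hp0 hz0.le) hzz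
  have hxp : ∀ p ∈ (Finset.Ioc ⌊a⌋₊ ⌊b⌋₊).filter Nat.Prime, Real.log x ≤ (k + 1) * Real.log p :=
    fun p hp => by
    obtain ⟨h1, -⟩ := hpS p hp
    calc Real.log x ≤ (k + 1) * Real.log y := hxy
      _ ≤ (k + 1) * Real.log p := by gcongr
  exact abs_card_roughIcc_sub_main_step_of hk hC hC₀ hE hP hN.symm hM.symm hNM hS hx0 hx1.le hy0 hy1
    hly hz0 hz2 hzx hzz hyz.le hlz hz_log hyu hxy hea hay hya hab hbz hzb hb0 hlb hlya hxa hpy hpx hxp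

end Literature.NumberTheory.Sieve
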